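import Summits.ABC.IUTFork.Conditional.HexDepthRadThirty
import Literature.IUT.LogVolume.UnitLogMaxNorm
import HarnessLib

/-!
# Branch C / R-W lane P− «HEX-SHARP», the RAD engine in CLOSED FORM: for EVERY prime `l ≥ 11` and every
# `k ≥ 2⌈log₇(5l)⌉ + 3`, at EVERY genuine Θ-volume datum over `λ_k = 1/2 + 2/7^k` the hull-level clause S_H FAILS (per datum)

PROOF-ONLY file (D-0012; 0 definitions, 0 `Prop` facts, no instance, no notation) of the abc-iut cell (WAVE-4 prover seat abc-iut-w4-d078,
gen 7; D-0079 R-W «WINDOW Θ-SIDE INEQUALITY», lane P−; abc-iut-plan g9 20:22:54Z «closed-form k♯ extension», claim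
«W:HEX-RAD-CLOSED-FORM» HOME/STATUS 2026-08-26T21:06Z). TAKES NO SIDE on [IUTchIII] Cor. 3.12 (S. Mochizuki, *Inter-universal Teichmüller
theory III*, RIMS manuscript, Cor. 3.12 pp. 173–174, Step (xi-f) p. 184) or on any author. NO new engine — what is added is ONE integer
criterion UNIFORM in `(l, S)` feeding, BY NAME, abc-iut-W-neg-2's HEX-RAD engine `HexRad.not_pilotKummerCompatHull_lamSeven_of_criterion`
(p465742; abc-iut-W-num-6's RAD-UNIFORM core p462893, abc-iut-c312-3's star × envelope socket p454852, abc-iut-c312-7's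
`GenuineK.exists_place_lamSeven`) at abc-iut-W-neg-1's exact Tate type `e(K_{x₀}/ℚ_7) ≤ 30·l`
(`GenuineK.absRamificationIdx_kOf_le_thirty_mul_lamSeven`), and W-neg-2's decided rows `…_rad_nine` (p466345) for `l ≤ 68`.

THE ARITHMETIC (§1). With `E = 30·l`, `l = 2j+1`, `S` the turning index of `E` at `7` (`7^{S−1}·6 < E ≤ 7^S·6`) and `S ≥ 4` (⟺ `l ≥ 69`):
`7^{S−1} ≥ 35S + 50` (induction), hence `2j ≥ 7S + 10`; with `F := ⌊(5j²k − 12j² − 13j − 6)/(5l)⌋` and `k ≥ 2S + 3` the two integer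
inequalities of W-num-6's criterion hold, the second because `7^S ≥ 5l` and
`6(N − 5l) − 30k − 5l(j+1)(6S−1) ≥ 28j² − (90S+123)j − (90S+151) > 0` (`N` the numerator of `F`; the quadratic is positive on `2j ≥ 7S+10`:
`2·Q = 14u² + 56S² + 106uS + 157u + 19S − 132`, `u = 2j − 7S − 10 ≥ 0`).

WHAT IS PROVED (namespace `Summit.ABC.IUTFork.Conditional`).
* `HexRad.seven_pow_pred_ge` — `35S + 50 ≤ 7^{S−1}` for `S ≥ 4`.
* `HexRad.criterion_thirty_closed_form` — the RAD-UNIFORM criterion at `E = 30l` for odd `l ≥ 11`, turning index `S ≥ 4`, every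
  `k ≥ 2S + 3` (conclusion in the hypothesis shape of p465742).
* `HexRad.not_pilotKummerCompatHull_lamSeven_rad_closed_form` — **for EVERY prime `l ≥ 11`, every `m` with `5l ≤ 7^m` and every
  `k ≥ 2m + 3`**: at every genuine Θ-volume datum `T` over `(ratPoint λ_k, l)`, for every choice of the free context binders and Kummer
  datum, the hull-level clause `Cor312Vol.PilotKummerCompatHull` at the sharp genuine setting over `T.K` with the CHOSEN realising ideles and
  the PINNED reading (verbatim the per-datum object of `hSH`/`hSHw`/`hSHwBad` and of the HEX files of record) is FALSE. Reading: the kernel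
  HEX frontier is `k ≥ 2⌈log₇(5l)⌉ + 3` at EVERY prime — `k ≥ 11` on `69 ≤ l ≤ 480` (W-neg-2 has `10` to `317`, `11` to `479`), `k ≥ 13`
  on `481 ≤ l ≤ 3361`, `k ≥ 15` on `3362 ≤ l ≤ 23529`, `k ≥ 17` to `164708`, … — the large-`l` tail of the HEX family closed by ONE theorem
  (no table, no upper bound on `l`).

HONEST SCOPE (binding, as in the engine consumed): an UPPER BOUND on the hull read at ONE diagonal summand (the top label over `7`); SHARP
reading (Θ-possible-image set constant in `m`, typed (Ind1)/(Ind2) = Dupuy–Hilado families); the per-label licence is a STRONGER-THAN-PRINT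
sufficient form of (xi-f); nothing about the printed GLOBAL inequality `−|log(q)| ≤ −|log(Θ)|`, the number-level `Cor22.Cor312AtDatum`
(HEX data are Szpiro-good — abc-iut-plan g9 reading of record 19:46Z: these rows bear on the uncut `hSHw` only) or any author's intended
hull; admissibility / (P6) of `(ratPoint λ_k, l)` and non-emptiness of the datum type NOT claimed; «refuted as typed» ≠ «refuted in print»;
typed ≠ proved; instantiated ≠ endorsed; no abc claim. [cite: Mochizuki2012, IUTchIII Cor. 3.12 Step (xi-f) p. 184; IUTchIV Prop. 1.1 p. 9,
Prop. 1.2 (i)(ii) p. 10, Cor. 2.2 (ii) proof (P5) p. 46; IUTchI Def. 3.1 (b),(c),(e) pp. 61–62, Ex. 3.2 (iv) p. 71]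
[cite: DupuyHilado2025, §3.3, §3.4, §4.9, §4.12] [cite: NeukirchANT1999, Ch. II (5.5)] [cite: ScholzeStix2018, §2.2 pp. 9–10]
[claim: Mochizuki2012, status: disputed] for every IUT sentence quoted.
-/

noncomputable section

open Set Function NumberField IsDedekindDomain

namespace Summit.ABC.IUTFork.Conditional

open Thm311 Thm311.Real Cor312 Cor312Vol Cor312Prov Literature.IUT.LogThetaLattice Literature.IUT.LogVolume
  Literature.IUT.HodgeTheaters Literature.IUT.LogVolume.ThetaData Literature.IUT.LogVolume.LogEnvelope
  Literature.NumberTheory.NumberFields Literature.NumberTheory.DiophantineGeometry.GenEll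
  Literature.NumberTheory.DiophantineGeometry Summit.ABC.ABC.Theorems

/-! ## §1. The closed-form integer criterion at `E = 30·l` -/

/-- `7^{S−1} ≥ 35·S + 50` for `S ≥ 4` (`7³ = 343 ≥ 190`, then `×7` against `+35`). [folklore] -/
theorem HexRad.seven_pow_pred_ge {S : ℕ} (hS : 4 ≤ S) : 35 * S + 50 ≤ 7 ^ (S - 1) := by
  induction S, hS using Nat.le_induction with
  | base => norm_num
  | succ m hm ih =>
    have h7 : 7 ^ (m + 1 - 1) = 7 ^ (m - 1) * 7 := by
      rw [← pow_succ]; congr 1; omega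
    rw [h7]
    omega

/-- **W-num-6's RAD criterion at `E = 30·l` IN CLOSED FORM**: for odd `l ≥ 11`, a turning index `S ≥ 4` of `30l` at `7`
(`7^{S−1}·6 < 30l ≤ 7^S·6`) and every `k ≥ 2S + 3`, with `j = (l−1)/2` and `F := ⌊(5j²k − 5jl − (j+1)(l+5))/(5l)⌋`:
`5l·F ≤ 5j²k − 5jl − (j+1)(l+5)` and `(j+1)·l·(S·30l − 7^S) < (F·l − k)·30l` (from `7^{S−1} ≥ 35S + 50 ⇒ 2j ≥ 7S + 10`,
`7^S ≥ 5l`, and `28j² − (90S+123)j − (90S+151) > 0`). [folklore] -/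
theorem HexRad.criterion_thirty_closed_form {k l S : ℕ} (h11 : 11 ≤ l) (hodd : l % 2 = 1) (hS4 : 4 ≤ S)
    (hlo : (7 : ℤ) ^ (S - 1) * ((7 : ℤ) - 1) < ((30 * l : ℕ) : ℤ))
    (hhi : ((30 * l : ℕ) : ℤ) ≤ (7 : ℤ) ^ S * ((7 : ℤ) - 1)) (hk : 2 * S + 3 ≤ k) :
    ∃ F : ℤ, 5 * (l : ℤ) * F ≤ 5 * ((l - 1) / 2 : ℕ) ^ 2 * k - 5 * ((l - 1) / 2 : ℕ) * l - (((l - 1) / 2 : ℕ) + 1) * (l + 5) ∧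
      (((l - 1) / 2 : ℕ) + 1 : ℤ) * l * (S * ((30 * l : ℕ)) - 7 ^ S) < (F * l - k) * ((30 * l : ℕ)) := by
  obtain ⟨j, rfl⟩ : ∃ j, l = 2 * j + 1 := ⟨l / 2, by omega⟩
  have hj : (2 * j + 1 - 1) / 2 = j := by omega
  rw [hj]
  -- the numerator and the floor
  set N : ℤ := 5 * (j : ℤ) ^ 2 * k - 5 * (j : ℤ) * (2 * j + 1) - ((j : ℤ) + 1) * (2 * j + 1 + 5) with hN
  have h5l : (0 : ℤ) < 5 * (2 * (j : ℤ) + 1) := by positivity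
  set F : ℤ := N / (5 * (2 * (j : ℤ) + 1)) with hF
  refine ⟨F, ?_, ?_⟩
  · have h := Int.ediv_mul_le N h5l.ne'
    push_cast
    linarith
  · have hlow := Int.lt_ediv_add_one_mul_self N h5l
    -- `2j ≥ 7S + 10` from `35S + 50 ≤ 7^{S-1} < 5l = 10j + 5`
    have hpow : (35 * S + 50 : ℤ) ≤ (7 : ℤ) ^ (S - 1) := by exact_mod_cast HexRad.seven_pow_pred_ge hS4
    have hlo' : (7 : ℤ) ^ (S - 1) * 6 < 30 * (2 * (j : ℤ) + 1) := by
      have h := hlo; push_cast at h; linarith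
    have hjS : 7 * (S : ℤ) + 10 ≤ 2 * j := by omega
    -- `7^S ≥ 5l`
    have h7S : 5 * (2 * (j : ℤ) + 1) ≤ (7 : ℤ) ^ S := by
      have h := hhi; push_cast at h; linarith
    -- the quadratic
    have hu : (0 : ℤ) ≤ 2 * (j : ℤ) - 7 * S - 10 := by linarith
    have hS0 : (4 : ℤ) ≤ S := by exact_mod_cast hS4
    have hQ : (0 : ℤ) < 28 * (j : ℤ) ^ 2 - (90 * S + 123) * j - (90 * S + 151) := by
      nlinarith [mul_nonneg hu hu, mul_nonneg hu (by linarith : (0 : ℤ) ≤ S), mul_nonneg (by linarith : (0 : ℤ) ≤ S) (by linarith : (0 : ℤ) ≤ S)]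
    have hl0 : (0 : ℤ) < 2 * (j : ℤ) + 1 := by positivity
    have hk' : (0 : ℤ) ≤ (k : ℤ) - 2 * S - 3 := by
      have : (2 * S + 3 : ℤ) ≤ k := by exact_mod_cast hk
      linarith
    have hj21 : (0 : ℤ) ≤ (j : ℤ) ^ 2 - 1 := by nlinarith
    have hjl0 : (0 : ℤ) ≤ ((j : ℤ) + 1) * (2 * j + 1) := by positivity
    push_cast
    nlinarith [mul_lt_mul_of_pos_left hlow hl0, mul_le_mul_of_nonneg_left h7S hjl0,
      mul_nonneg (mul_nonneg hl0.le hk') hj21, mul_pos hl0 hQ]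

/-! ## §2. The HEX rows at every prime, closed form -/

/-- **HEX-RAD IN CLOSED FORM: every prime `l ≥ 11`, every `m` with `5l ≤ 7^m`, every `k ≥ 2m + 3`.** At EVERY genuine Θ-volume datum `T`
over `(ratPoint λ_k, l)`, for EVERY region field, columns, frames, lattice, Frobenioid signature, q-pilot data and Kummer datum `qK`, the
hull-level clause S_H (`Cor312Vol.PilotKummerCompatHull` at the sharp genuine K-setting, CHOSEN realising ideles, PINNED reading) is FALSE:
for `l ≤ 68` (`m ≥ 3`, `k ≥ 9`) this is abc-iut-W-neg-2's `HexRad.not_pilotKummerCompatHull_lamSeven_rad_nine`; for `l ≥ 69` the turning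
index `S` of `30l` (`LogEnvelope.exists_turning`) has `4 ≤ S ≤ m`, and §1 feeds W-neg-2's engine at W-neg-1's exact Tate type `e ≤ 30·l`.
The kernel HEX frontier is thus `k ≥ 2⌈log₇(5l)⌉ + 3` at every prime `l`. [cite: Mochizuki2012, IUTchIII Cor. 3.12 Step (xi-f) p. 184;
IUTchIV Prop. 1.2 (i)(ii) p. 10; IUTchI Ex. 3.2 (iv) p. 71] [claim: Mochizuki2012, status: disputed] -/
theorem HexRad.not_pilotKummerCompatHull_lamSeven_rad_closed_form {k l m : ℕ} (hl : l.Prime) (h11 : 11 ≤ l)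
    (hm : 5 * l ≤ 7 ^ m) (hk : 2 * m + 3 ≤ k)
    (T : Cor22.ThetaVolumeDatumAt (ratPoint ((2 : ℚ)⁻¹ + 2 / 7 ^ k)) l) :
    letI := T.instFieldF; letI := T.instNumberFieldF; letI := T.instAlgebraF; letI := T.instFieldK
    letI := T.instNumberFieldK; letI := T.instAlgebraK; letI := T.instFieldFbar; letI := T.instAlgebraFbar
    letI := T.instAlgebraKFbar; letI := T.instIsElliptic
    ∀ (M : Type) [Field M] [NumberField M]
      (archPk : ∀ (j : (thetaIndex (pilotDataOfK T.D T.K)).Label) (vQ : (thetaIndex (pilotDataOfK T.D T.K)).VQ),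
        Set ((logShellsDH (pilotDataOfK T.D T.K) (analyticLogv T.K)).Packet j vQ))
      (archSub : ∀ (j : (thetaIndex (pilotDataOfK T.D T.K)).Label) (v : (thetaIndex (pilotDataOfK T.D T.K)).V),
        Set ((logShellsDH (pilotDataOfK T.D T.K) (analyticLogv T.K)).Packet j ((thetaIndex (pilotDataOfK T.D T.K)).over v)))
      (Ψ : ℤ → ∀ v : (thetaIndex (pilotDataOfK T.D T.K)).V, v ∈ (thetaIndex (pilotDataOfK T.D T.K)).Vbad →
        Set ((logShellsDH (pilotDataOfK T.D T.K) (analyticLogv T.K)).StarPacket v))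
      (act : ℤ → ∀ v : (thetaIndex (pilotDataOfK T.D T.K)).V, v ∈ (thetaIndex (pilotDataOfK T.D T.K)).Vbad →
        (logShellsDH (pilotDataOfK T.D T.K) (analyticLogv T.K)).StarPacket v →
          Module.End ℚ ((logShellsDH (pilotDataOfK T.D T.K) (analyticLogv T.K)).StarPacket v))
      (Mmod : ℤ → ∀ j : (thetaIndex (pilotDataOfK T.D T.K)).LabelStar,
        Set ((logShellsDH (pilotDataOfK T.D T.K) (analyticLogv T.K)).GlobalPacket j.1))
      (region : ℤ → ∀ j : (thetaIndex (pilotDataOfK T.D T.K)).LabelStar, FinDivisor M →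
        ∀ vQ : (thetaIndex (pilotDataOfK T.D T.K)).VQ, Set ((logShellsDH (pilotDataOfK T.D T.K) (analyticLogv T.K)).Packet j.1 vQ))
      (frobAdm : ℤ → ℤ → ∀ (j : (thetaIndex (pilotDataOfK T.D T.K)).Label) (vQ : (thetaIndex (pilotDataOfK T.D T.K)).VQ),
        Set ((logShellsDH (pilotDataOfK T.D T.K) (analyticLogv T.K)).Packet j vQ) → Prop)
      (frobLogvol : ℤ → ℤ → ∀ (j : (thetaIndex (pilotDataOfK T.D T.K)).Label) (vQ : (thetaIndex (pilotDataOfK T.D T.K)).VQ),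
        Set ((logShellsDH (pilotDataOfK T.D T.K) (analyticLogv T.K)).Packet j vQ) → ℝ)
      (frobΨ : ℤ → ℤ → ∀ v : (thetaIndex (pilotDataOfK T.D T.K)).V, v ∈ (thetaIndex (pilotDataOfK T.D T.K)).Vbad →
        Set ((logShellsDH (pilotDataOfK T.D T.K) (analyticLogv T.K)).StarPacket v))
      (frobMmod : ℤ → ℤ → ∀ j : (thetaIndex (pilotDataOfK T.D T.K)).LabelStar,
        Set ((logShellsDH (pilotDataOfK T.D T.K) (analyticLogv T.K)).GlobalPacket j.1))
      (unitImage : ℤ → ℤ → ℕ → ∀ (j : (thetaIndex (pilotDataOfK T.D T.K)).Label) (vQ : (thetaIndex (pilotDataOfK T.D T.K)).VQ),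
        Set ((logShellsDH (pilotDataOfK T.D T.K) (analyticLogv T.K)).Packet j vQ))
      (ballImage : ℤ → ℤ → ∀ (j : (thetaIndex (pilotDataOfK T.D T.K)).Label) (vQ : (thetaIndex (pilotDataOfK T.D T.K)).VQ),
        Set ((logShellsDH (pilotDataOfK T.D T.K) (analyticLogv T.K)).Packet j vQ))
      (thetaDiv : ℤ → ℤ → LgpDivisor M (thetaIndex (pilotDataOfK T.D T.K)).lstar)
      (n : ℤ) {HT : Type} {LogLink : HT → HT → Type} {IsFull : ∀ {s t : HT}, LogLink s t → Prop}
      (lat : LGPGaussianLogThetaLattice LogLink IsFull)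
      {Frd : Type} {IsoF : Frd → Frd → Type} {Ob : Frd → Type} {realify : Frd → Frd} {Strip : Type}
      {IsoS : Strip → Strip → Type} {Mv : ∀ v : (thetaIndex (pilotDataOfK T.D T.K)).V, v ∈ (thetaIndex (pilotDataOfK T.D T.K)).Vbad → Type}
      [∀ v h, Monoid (Mv v h)]
      (sig : GlobalLGPFrobenioidSignature (thetaIndex (pilotDataOfK T.D T.K)).lstar (thetaIndex (pilotDataOfK T.D T.K)).V
        (· ∈ (thetaIndex (pilotDataOfK T.D T.K)).Vbad) Frd IsoF Ob realify Strip IsoS Mv)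
      (split : SplittingMonoids Mv) {ObΔ : Type}
      {N : ∀ v : (thetaIndex (pilotDataOfK T.D T.K)).V, v ∈ (thetaIndex (pilotDataOfK T.D T.K)).Vbad → Type}
      [∀ v h, Monoid (N v h)] (qData : QPilotData ObΔ N)
      (qK : ∀ v : (thetaIndex (pilotDataOfK T.D T.K)).V, v ∈ (thetaIndex (pilotDataOfK T.D T.K)).Vbad →
        Set ((logShellsDH (pilotDataOfK T.D T.K) (analyticLogv T.K)).StarPacket v)),
    ¬ Cor312Vol.PilotKummerCompatHull
        (LatticeSituation.ofShells (logShellsDH (pilotDataOfK T.D T.K) (analyticLogv T.K)) M archPk archSub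
          (summandPiecesPr (pilotDataOfK T.D T.K) (logvAnalytic_analyticLogv (F := T.K))).Adm
          (summandPiecesPr (pilotDataOfK T.D T.K) (logvAnalytic_analyticLogv (F := T.K))).logvol Ψ act Mmod region frobAdm
          frobLogvol frobΨ frobMmod unitImage ballImage thetaDiv)
        (settingPrVolSharp (pilotDataOfK T.D T.K) (logvAnalytic_analyticLogv (F := T.K)) M archPk archSub Ψ act Mmod region n
          lat sig split qData (exists_realising_qIdeles_pilotDataOfK T.D).choose (exists_realising_thetaIdeles_pilotDataOfK T.D).choose
          (exists_realising_qIdeles_pilotDataOfK T.D).choose_spec.1 (exists_realising_qIdeles_pilotDataOfK T.D).choose_spec.2.1)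
        (fun _ => Cor312.Setting.qRegion
          (settingPrVolSharp (pilotDataOfK T.D T.K) (logvAnalytic_analyticLogv (F := T.K)) M archPk archSub Ψ act Mmod region n
            lat sig split qData (exists_realising_qIdeles_pilotDataOfK T.D).choose (exists_realising_thetaIdeles_pilotDataOfK T.D).choose
            (exists_realising_qIdeles_pilotDataOfK T.D).choose_spec.1 (exists_realising_qIdeles_pilotDataOfK T.D).choose_spec.2.1))
        qK := by
  have hodd : l % 2 = 1 := Nat.odd_iff.mp (hl.odd_of_ne_two (by omega))
  -- `m ≥ 3` since `5l ≥ 55 > 49`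
  have hm3 : 3 ≤ m := by
    by_contra h
    have h' : m ≤ 2 := by omega
    interval_cases m <;> norm_num at hm <;> omega
  by_cases h68 : l ≤ 68
  · exact HexRad.not_pilotKummerCompatHull_lamSeven_rad_nine (by omega) hl h11 (by omega) T
  · haveI : Fact (Nat.Prime 7) := ⟨by norm_num⟩
    obtain ⟨S, hloS, hhiS⟩ := LogEnvelope.exists_turning (p := 7) (30 * l)
    have hloS' : ∀ a < S, (7 : ℤ) ^ a * ((7 : ℤ) - 1) < ((30 * l : ℕ) : ℤ) := fun a ha => by exact_mod_cast hloS a ha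
    have hhiS' : ((30 * l : ℕ) : ℤ) ≤ (7 : ℤ) ^ S * ((7 : ℤ) - 1) := by exact_mod_cast hhiS
    -- `S ≥ 4`: `30l ≥ 2070 > 2058 = 7³·6`
    have hS4 : 4 ≤ S := by
      by_contra h
      have h3 : (7 : ℤ) ^ S ≤ 343 :=
        calc (7 : ℤ) ^ S ≤ 7 ^ 3 := pow_le_pow_right₀ (by norm_num) (by omega)
          _ = 343 := by norm_num
      have h69 : (69 : ℤ) ≤ l := by exact_mod_cast (show 69 ≤ l by omega)
      have h := hhiS'
      push_cast at h
      linarith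
    -- `S ≤ m`: `7^{S-1}·6 < 30l ≤ 6·7^m`
    have hSm : S ≤ m := by
      have h1 := hloS' (S - 1) (by omega)
      have hmZ : (30 * l : ℤ) ≤ 6 * 7 ^ m := by exact_mod_cast (show 30 * l ≤ 6 * 7 ^ m by omega)
      have hlt : (7 : ℤ) ^ (S - 1) < 7 ^ m := by
        push_cast at h1
        linarith
      have h2 := (pow_lt_pow_iff_right₀ (by norm_num : (1 : ℤ) < 7)).mp hlt
      omega
    obtain ⟨F, hF, hcrit⟩ :=
      HexRad.criterion_thirty_closed_form (k := k) (by omega) hodd hS4 (hloS' (S - 1) (by omega)) hhiS' (by omega)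
    exact HexRad.not_pilotKummerCompatHull_lamSeven_of_criterion (by omega) hl h11 hloS' hhiS' hF hcrit T
      (GenuineK.absRamificationIdx_kOf_le_thirty_mul_lamSeven (by omega) h11 T)

end Summit.ABC.IUTFork.Conditional

end
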